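import Literature.Analysis.UnboundedOperators.LinearizedBoltzmannGaussGrowth
import Literature.Analysis.FluidPDE.SphereGaussianFluxBounds
import HarnessLib

/-!
# The hard-sphere gain operator on Gaussian weights

For the linearised hard-sphere collision operator around the normalised Maxwellian `M` of `ℝ³`
(`LinearizedBoltzmann.lean`; Grad's splitting `L = 2K₂' - K₁ - ν`, CIP 1994 §7.2) we bound the first
gain integral on the Gaussian weights `W_θ = e^{θ|·|²}`, `0 < θ < 1/2`
(`exists_lintegral_gain_fst_gaussWeight_le`):

`∫∫ ((v - v_*)·ω)₊ M(v_*) e^{θ|v'|²} dω dv_* ≤ K(θ) e^{θ|v|²} / |v|`   (`v ≠ 0`).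

Since `ν(v) ≳ |v|`, this says `(ν⁻¹ K₂ W_θ)(v) = O(|v|⁻²) W_θ(v)`: every Gaussian weight strictly
between `1` and `M^{-1/2}` is a strict supersolution of Grad's integral equation at large speed — the
mechanism of the weighted sup-norm theory of `L⁻¹` (Grad 1963; Guo, ARMA 197 (2010), Lemma 3), here
in the `M`-weighted picture `ψ = f / M`. Ingredients: conservation of energy in the form
`|v'|² = |v|² - ⟪v, ω⟫² + ⟪v_*, ω⟫²` (the tree's `norm_sq_collide_fst_eq`), so that
`e^{θ|v'|²} ≤ e^{θ|v|²} e^{-θ⟪v, ω⟫²} e^{θ|v_*|²}`; the angular decay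
`∫ (|⟪v, ω⟫| + |v_*|) e^{-θ⟪v, ω⟫²} dω = O((1 + |v_*|)/|v|)` of
`Literature.Analysis.FluidPDE.SphereGaussianFluxBounds` (hat-box theorem + equatorial band); and the
integrability of `(1 + |v_*|) M(v_*) e^{θ|v_*|²}` for `θ < 1/2`. The borderline weight `θ = 0`
(bounded functions) is NOT a supersolution (`ν⁻¹ K₂ 1 = 2`), cf.
`LinearizedBoltzmannOrthogonalInverseUnbounded`. No new definitions are introduced.
-/

open MeasureTheory Metric Real Set Filter Topology ProbabilityTheory Module
open scoped InnerProductSpace ENNReal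

namespace Literature.Analysis.UnboundedOperators

noncomputable section

open Literature.MathematicalPhysics.KineticTheory (collide sphereMeasure hardSphereKernel)
open Literature.Analysis.FluidPDE

section GeneralE

variable {E : Type*} [NormedAddCommGroup E] [InnerProductSpace ℝ E]

/-! ### Energy bookkeeping of a hard-sphere collision -/

/-- The Gaussian weight after a collision: `e^{θ|v'|²} ≤ e^{θ|v|²} e^{-θ⟪v, ω⟫²} e^{θ|v_*|²}` for
`θ ≥ 0`. [folklore] -/
theorem exp_mul_norm_sq_collide_fst_le {θ : ℝ} (hθ : 0 ≤ θ) (ω : sphere (0 : E) 1) (v w : E) :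
    Real.exp (θ * ‖(collide ω (v, w)).1‖ ^ 2) ≤
      Real.exp (θ * ‖v‖ ^ 2) * Real.exp (-θ * ⟪v, (ω : E)⟫_ℝ ^ 2) * Real.exp (θ * ‖w‖ ^ 2) := by
  rw [← Real.exp_add, ← Real.exp_add, norm_sq_collide_fst_eq]
  refine Real.exp_le_exp.2 ?_
  have h := abs_inner_sphere_le w ω
  have h2 : ⟪w, (ω : E)⟫_ℝ ^ 2 ≤ ‖w‖ ^ 2 := by
    rw [← sq_abs]; exact pow_le_pow_left₀ (abs_nonneg _) h 2
  nlinarith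

/-- Pointwise bound of the weighted gain integrand:
`((v - v_*)·ω)₊ M(v_*) e^{θ|v'|²} ≤ e^{θ|v|²} · (|⟪v, ω⟫| + |v_*|) e^{-θ⟪v, ω⟫²} · M(v_*) e^{θ|v_*|²}`.
[folklore] -/
theorem kernel_mul_globalMaxwellian_mul_exp_collide_le {θ : ℝ} (hθ : 0 ≤ θ) (ω : sphere (0 : E) 1) (v w : E) :
    hardSphereKernel (v, w) ω * globalMaxwellian w * Real.exp (θ * ‖(collide ω (v, w)).1‖ ^ 2) ≤
      Real.exp (θ * ‖v‖ ^ 2) * ((|⟪v, (ω : E)⟫_ℝ| + ‖w‖) * Real.exp (-θ * ⟪v, (ω : E)⟫_ℝ ^ 2)) *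
        (globalMaxwellian w * Real.exp (θ * ‖w‖ ^ 2)) := by
  have hB0 : 0 ≤ hardSphereKernel (v, w) ω := le_max_right _ _
  have hB := hardSphereKernel_le_abs_inner_add_norm v w ω
  have hM := (globalMaxwellian_pos w).le
  have he := exp_mul_norm_sq_collide_fst_le hθ ω v w
  calc hardSphereKernel (v, w) ω * globalMaxwellian w * Real.exp (θ * ‖(collide ω (v, w)).1‖ ^ 2)
      ≤ (|⟪v, (ω : E)⟫_ℝ| + ‖w‖) * globalMaxwellian w *
          (Real.exp (θ * ‖v‖ ^ 2) * Real.exp (-θ * ⟪v, (ω : E)⟫_ℝ ^ 2) * Real.exp (θ * ‖w‖ ^ 2)) :=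
        mul_le_mul (mul_le_mul_of_nonneg_right hB hM) he (Real.exp_nonneg _)
          (mul_nonneg ((abs_nonneg _).trans (le_add_of_nonneg_right (norm_nonneg _))) hM)
    _ = _ := by ring

/-- `M(w) e^{θ|w|²} = (2π)^{-d/2} e^{-((1 - 2θ)/2)|w|²}`. [folklore] -/
theorem globalMaxwellian_mul_exp (θ : ℝ) (w : E) :
    globalMaxwellian w * Real.exp (θ * ‖w‖ ^ 2) =
      (2 * π) ^ (-(finrank ℝ E : ℝ) / 2) * Real.exp (-((1 - 2 * θ) / 2) * ‖w‖ ^ 2) := by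
  simp only [globalMaxwellian]
  rw [mul_assoc, ← Real.exp_add]
  congr 2
  ring

variable [FiniteDimensional ℝ E] [MeasurableSpace E] [BorelSpace E]

/-- `(1 + |w|) M(w) e^{θ|w|²}` is Lebesgue integrable for `θ < 1/2`. [folklore] -/
theorem integrable_one_add_norm_mul_globalMaxwellian_mul_exp_of_lt_half {θ : ℝ} (hθ : θ < 1 / 2) :
    Integrable (fun w : E => (1 + ‖w‖) * (globalMaxwellian w * Real.exp (θ * ‖w‖ ^ 2))) := by
  have h := (integrable_one_add_norm_mul_exp (E := E) (β := 1 - 2 * θ) (by linarith)).const_mul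
    ((2 * π) ^ (-(finrank ℝ E : ℝ) / 2))
  refine h.congr (Eventually.of_forall fun w => ?_)
  simp only [globalMaxwellian_mul_exp]
  ring

/-- A bounded function has `L²(M dv)`-norm at most its bound (`M dv` is a probability measure).
[folklore] -/
theorem eLpNorm_two_toReal_le_of_abs_le {g : E → ℝ} {b : ℝ} (hb : ∀ v, |g v| ≤ b) :
    (eLpNorm g 2 (stdGaussian E)).toReal ≤ b := by
  have hb0 : 0 ≤ b := (abs_nonneg _).trans (hb 0)
  have h := eLpNorm_le_of_ae_bound (p := 2) (μ := stdGaussian E) (f := g) (C := b)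
    (Eventually.of_forall fun v => by rw [Real.norm_eq_abs]; exact hb v)
  simp only [measure_univ, ENNReal.one_rpow, one_mul] at h
  exact (ENNReal.toReal_mono ENNReal.ofReal_ne_top h).trans (by rw [ENNReal.toReal_ofReal hb0])

end GeneralE

/-! ### The gain operator on Gaussian weights decays like `|v|⁻¹ e^{θ|v|²}` (`ℝ³`) -/

/-- **The first gain integral of a Gaussian weight** (`ℝ³`, `0 < θ < 1/2`): there is `K = K(θ)` with
`∫∫ ((v - v_*)·ω)₊ M(v_*) e^{θ|v'|²} dω dv_* ≤ K e^{θ|v|²} / |v|` for every `v ≠ 0`. By conservation of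
energy `e^{θ|v'|²} ≤ e^{θ|v|²} e^{-θ⟪v,ω⟫²} e^{θ|v_*|²}`; the angular integral
`∫ (|⟪v,ω⟫| + |v_*|) e^{-θ⟪v,ω⟫²} dω = O((1 + |v_*|)/|v|)` is Archimedes' hat-box theorem plus the
equatorial band estimate (`lintegral_toSphere_abs_inner_add_mul_exp_neg_le`), and
`(1 + |v_*|) M(v_*) e^{θ|v_*|²}` is integrable. In particular `(ν⁻¹ K₂ e^{θ|·|²})(v) = O(|v|⁻²) e^{θ|v|²}`:
Gaussian weights strictly between `1` and `M^{-1/2}` are strict supersolutions at large speed, the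
mechanism of Grad's / Guo's weighted sup-norm theory (Guo 2010, Lemma 3). [folklore] -/
theorem exists_lintegral_gain_fst_gaussWeight_le {θ : ℝ} (hθ0 : 0 < θ) (hθ : θ < 1 / 2) :
    ∃ K : ℝ, 0 ≤ K ∧ ∀ v : EuclideanSpace ℝ (Fin 3), v ≠ 0 →
      ∫⁻ w, ∫⁻ ω, ENNReal.ofReal (hardSphereKernel (v, w) ω * globalMaxwellian w) *
          ENNReal.ofReal (Real.exp (θ * ‖(collide ω (v, w)).1‖ ^ 2)) ∂sphereMeasure ≤
        ENNReal.ofReal (K * Real.exp (θ * ‖v‖ ^ 2) / ‖v‖) := by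
  set I : ℝ := ∫ w : EuclideanSpace ℝ (Fin 3), (1 + ‖w‖) * (globalMaxwellian w * Real.exp (θ * ‖w‖ ^ 2)) with hI
  have hIi := integrable_one_add_norm_mul_globalMaxwellian_mul_exp_of_lt_half (E := EuclideanSpace ℝ (Fin 3)) hθ
  have hI0 : 0 ≤ I := integral_nonneg fun w => by
    have := (globalMaxwellian_pos w).le; positivity
  set A : ℝ := 2 * Real.pi / θ + 512 * Real.pi with hA
  have hA0 : 0 ≤ A := by positivity
  refine ⟨A * I, mul_nonneg hA0 hI0, fun v hv => ?_⟩
  have hvn : 0 < ‖v‖ := norm_pos_iff.2 hv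
  -- Step 1: pointwise bound
  set F : EuclideanSpace ℝ (Fin 3) → sphere (0 : EuclideanSpace ℝ (Fin 3)) 1 → ℝ≥0∞ := fun w ω =>
    ENNReal.ofReal ((|⟪v, (ω : EuclideanSpace ℝ (Fin 3))⟫_ℝ| + ‖w‖) *
      Real.exp (-θ * ⟪v, (ω : EuclideanSpace ℝ (Fin 3))⟫_ℝ ^ 2)) with hF
  set G : EuclideanSpace ℝ (Fin 3) → ℝ≥0∞ := fun w =>
    ENNReal.ofReal (globalMaxwellian w * Real.exp (θ * ‖w‖ ^ 2)) with hG
  have hpt : ∀ w ω, ENNReal.ofReal (hardSphereKernel (v, w) ω * globalMaxwellian w) *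
      ENNReal.ofReal (Real.exp (θ * ‖(collide ω (v, w)).1‖ ^ 2)) ≤
      ENNReal.ofReal (Real.exp (θ * ‖v‖ ^ 2)) * G w * F w ω := by
    intro w ω
    have hBM : 0 ≤ hardSphereKernel (v, w) ω * globalMaxwellian w :=
      mul_nonneg (le_max_right _ _) (globalMaxwellian_pos w).le
    rw [hF, hG, ← ENNReal.ofReal_mul hBM, ← ENNReal.ofReal_mul (Real.exp_nonneg _),
      ← ENNReal.ofReal_mul (mul_nonneg (Real.exp_nonneg _) (mul_nonneg (globalMaxwellian_pos w).le (Real.exp_nonneg _)))]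
    refine ENNReal.ofReal_le_ofReal ?_
    have h := kernel_mul_globalMaxwellian_mul_exp_collide_le hθ0.le ω v w
    linarith [h]
  -- Step 2: the angular integral
  have hang : ∀ w, ∫⁻ ω, F w ω ∂sphereMeasure ≤ ENNReal.ofReal (A * (1 + ‖w‖) / ‖v‖) := by
    intro w
    have h := lintegral_toSphere_abs_inner_add_mul_exp_neg_le hv hθ0 (norm_nonneg w)
    refine h.trans (ENNReal.ofReal_le_ofReal (div_le_div_of_nonneg_right ?_ hvn.le))
    rw [hA]
    have e : (2 * Real.pi / θ + 512 * Real.pi) * (1 + ‖w‖) =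
        2 * Real.pi * (1 + ‖w‖) / θ + 512 * Real.pi * ‖w‖ + 512 * Real.pi := by ring
    rw [e]
    linarith [Real.pi_pos]
  -- Step 3: assemble
  have hGm : Measurable G :=
    ((continuous_globalMaxwellian.mul (by fun_prop)).measurable).ennreal_ofReal
  calc ∫⁻ w, ∫⁻ ω, ENNReal.ofReal (hardSphereKernel (v, w) ω * globalMaxwellian w) *
          ENNReal.ofReal (Real.exp (θ * ‖(collide ω (v, w)).1‖ ^ 2)) ∂sphereMeasure
      ≤ ∫⁻ w, ∫⁻ ω, ENNReal.ofReal (Real.exp (θ * ‖v‖ ^ 2)) * G w * F w ω ∂sphereMeasure :=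
        lintegral_mono fun w => lintegral_mono fun ω => hpt w ω
    _ = ∫⁻ w, ENNReal.ofReal (Real.exp (θ * ‖v‖ ^ 2)) * G w * ∫⁻ ω, F w ω ∂sphereMeasure := by
        refine lintegral_congr fun w => ?_
        rw [lintegral_const_mul' _ _ (ENNReal.mul_ne_top ENNReal.ofReal_ne_top ENNReal.ofReal_ne_top)]
    _ ≤ ∫⁻ w, ENNReal.ofReal (Real.exp (θ * ‖v‖ ^ 2)) * G w * ENNReal.ofReal (A * (1 + ‖w‖) / ‖v‖) :=
        lintegral_mono fun w => mul_le_mul' le_rfl (hang w)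
    _ = ∫⁻ w, ENNReal.ofReal (Real.exp (θ * ‖v‖ ^ 2) * A / ‖v‖) *
          ENNReal.ofReal ((1 + ‖w‖) * (globalMaxwellian w * Real.exp (θ * ‖w‖ ^ 2))) := by
        refine lintegral_congr fun w => ?_
        have hM := (globalMaxwellian_pos w).le
        rw [hG, ← ENNReal.ofReal_mul (Real.exp_nonneg _),
          ← ENNReal.ofReal_mul (mul_nonneg (Real.exp_nonneg _) (by positivity)),
          ← ENNReal.ofReal_mul (div_nonneg (mul_nonneg (Real.exp_nonneg _) hA0) hvn.le)]
        congr 1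
        field_simp
    _ = ENNReal.ofReal (Real.exp (θ * ‖v‖ ^ 2) * A / ‖v‖) * ENNReal.ofReal I := by
        rw [lintegral_const_mul' _ _ ENNReal.ofReal_ne_top, hI,
          ofReal_integral_eq_lintegral_ofReal hIi (Eventually.of_forall fun w => by
            have := (globalMaxwellian_pos w).le; positivity)]
    _ = ENNReal.ofReal (A * I * Real.exp (θ * ‖v‖ ^ 2) / ‖v‖) := by
        rw [← ENNReal.ofReal_mul (div_nonneg (mul_nonneg (Real.exp_nonneg _) hA0) hvn.le)]
        congr 1
        field_simp

end

end Literature.Analysis.UnboundedOperators
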